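import Summits.NavierStokesRegularity.NavierStokesRegularity.Theses.QuantisedSymmetry
import Literature.Analysis.FluidPDE.AncientSimilarityVariables
import Summits.NavierStokesRegularity.NavierStokesRegularity.Theorems.QuantisedSymmetryPolyhedralDssProfileExistsStubAncientMildOfClassicalTypeI
import Literature.Analysis.FluidPDE.ChaeWolfRemovingDSSProofs

/-!
# Birth skeleton (BC3) for crux `PolyhedralDssProfileExists` (X⁻) — route `QuantisedSymmetry`,
# summit NavierStokesRegularity (negative side)

Line `birth`. The canonical first move of every construction of a backward discretely
self-similar (DSS) Type-I blow-up profile is the passage to the **backward similarity (Leray)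
variables** `U(s, y) = √(−t) · u(t, x)`, `y = x/√(−t)`, `s = −log(−t)` (Chae–Wolf 2017, §4;
Bradshaw–Tsai 2017, §5, Open Problem 5.1; in tree: `Literature.Analysis.FluidPDE.lerayOrbit`,
`ofLerayOrbit`, `IsBackwardLeraySolutionOn` and the dictionary of
`Literature/Analysis/FluidPDE/AncientSimilarityVariables.lean`). In these variables a `λ`-DSS
Type-I ancient solution is exactly a `2 log λ`-PERIODIC ORBIT of the AUTONOMOUS backward Leray system
`∂ₛU + ½U + ½(y·∇)U + (U·∇)U + ∇P = ΔU`, `div U = 0`, obeying the time-independent profile bound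
`(1 + |y|) |U(s, y)| ≤ C₀` — the object on which the route's tools (equivariant Floquet count 7 → 1,
harmonic balance / Newton–Krylov continuation in the `G`-invariant sector) act. The crux is cut into

* `stub_periodicLerayOrbit` — TRANSFER `C⁺` (hard; the existence content of X⁻ in its natural
  variables): a finite irreducible proper rotation group `G ≤ SO(3)` (T/O/I) and a nontrivial
  `G`-equivariant time-periodic classical solution `(U, P)` of the backward Leray system on
  `ℝ × ℝ³` with the profile Type-I bound. Why easier than X⁻: an autonomous parabolic system and a
  periodic-orbit problem in a fixed weighted space, where Floquet / continuation / rigorous-numerics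
  (radii-polynomial) tools apply, with the 6 translation/rotation neutral modes removed by the
  irreducibility of `G` (route header, 'Two-layer plan', split of #2).
* `stub_ancientMild_of_classical_typeI` — the KNSS MILD GAUGE IS AUTOMATIC UNDER TYPE-I DECAY
  (genuine, M/L): a classical Navier–Stokes solution on the past `(−∞, 0) × ℝ³` (`ν = 1`, zero force)
  with `|u(t,x)| ≤ C₀/(|x| + √(−t))` is an ancient mild solution in the duality sense
  (`IsAncientMildSolution 1 u`): the spatial decay excludes the parasitic gauge `u = b(t)`,
  `p = −b'(t)·x` (KNSS 2009 §1; Seregin–Šverák 2009 (1.1); tree: docstring of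
  `Literature.Analysis.FluidPDE.IsTypeIAncientMild`), so the Fabes–Jones–Rivière pairing
  (tree: `IsClassicalNSSolutionOn.isMildNSSolutionOn_holds`, which assumes a BOUNDED pressure) goes
  through after the harmonic part of the pressure is shown to be affine and then zero by decay.

and the kernel-checked composition `PolyhedralDssProfileExists_of` (no sorry): the physical field
`u := ofLerayOrbit U` (junk value `0` for `t ≥ 0`) is classical on the past
(`isClassicalNSSolutionOn_Iio_ofLerayOrbit_iff`), Type I (`hasTypeIDecay_iff_lerayOrbit`), hence
ancient mild (stub 2), `λ`-DSS with `λ = e^{S/2} > 1` (`periodic_lerayOrbit_iff` on the past, both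
sides `0` on `t ≥ 0`), `G`-equivariant (linearity of the isometries), with continuous hence
measurable slices, and not a.e. trivial (a continuous slice a.e. zero is zero; `lerayOrbit ∘ ofLerayOrbit = id`).

Disproof used: none — no `Disproof.lean` / Negative lemma is filed for this crux (`ledger crux ls`, 2026-08-17).
-/

namespace Summit.NavierStokesRegularity.NavierStokesRegularity.Cruxes.PolyhedralDssProfileExists.Birth

open MeasureTheory Set Function Filter
open Literature.Analysis.FluidPDE

local notation "ℝ³" => EuclideanSpace ℝ (Fin 3)

/-! ## The two statements of the line (named, so that the composition's hypotheses are keyed by name) -/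

/-- **Statement of stub 1 (transfer `C⁺`).** See `stub_periodicLerayOrbit`. -/
def PeriodicLerayOrbitExists : Prop :=
    ∃ G : Subgroup (ℝ³ ≃ₗᵢ[ℝ] ℝ³), Finite G ∧
      (∀ g ∈ G, LinearMap.det (g.toLinearEquiv : ℝ³ →ₗ[ℝ] ℝ³) = 1) ∧
      (∀ V : Submodule ℝ ℝ³, (∀ g ∈ G, ∀ v ∈ V, g v ∈ V) → V = ⊥ ∨ V = ⊤) ∧
      ∃ S : ℝ, 0 < S ∧ ∃ (U : ℝ → ℝ³ → ℝ³) (P : ℝ → ℝ³ → ℝ),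
        IsBackwardLeraySolutionOn univ 1 U P ∧ Function.Periodic U S ∧
        (∃ C₀ : ℝ, ∀ s y, (1 + ‖y‖) * ‖U s y‖ ≤ C₀) ∧
        (∀ g ∈ G, ∀ s y, U s (g y) = g (U s y)) ∧ (∃ s y, U s y ≠ 0)

/-- **Statement of stub 2 (mild gauge under Type-I decay).** See `stub_ancientMild_of_classical_typeI`. -/
def AncientMildOfClassicalTypeI : Prop :=
    ∀ (u : ℝ → ℝ³ → ℝ³) (p : ℝ → ℝ³ → ℝ) (C₀ : ℝ),
      IsClassicalNSSolutionOn (Iio 0) 1 0 u p → HasTypeIDecay C₀ u → IsAncientMildSolution 1 u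

/-! ### Name-keyed aliases (hypothesis keys of `PolyhedralDssProfileExists_of`)

`Registered.stub_X` is the statement of `stub_X` under the registered stub's short name, so that the
native skeleton audit (`#h21_check_skeleton`: hypotheses admissible iff registered obligations /
declared stubs BY NAME) accepts `PolyhedralDssProfileExists_of : Registered.stub_periodicLerayOrbit →
Registered.stub_ancientMild_of_classical_typeI → PolyhedralDssProfileExists` (device of
`Cruxes/AdaptedKernelExists/Lines/similarity-ou-harnack-chain.lean`). Each alias is `rfl`-equal to the
literal signature of the sorried stub of the same short name. -/
namespace Registered

/-- Alias of `PeriodicLerayOrbitExists` keyed by the registered stub name. -/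
abbrev stub_periodicLerayOrbit : Prop := PeriodicLerayOrbitExists
/-- Alias of `AncientMildOfClassicalTypeI` keyed by the registered stub name. -/
abbrev stub_ancientMild_of_classical_typeI : Prop := AncientMildOfClassicalTypeI

end Registered

/-! ## Registered stubs (the ONLY `sorry`s of the file; literal signatures) -/

/-- **Stub 1 (transfer `C⁺`, hard): a polyhedrally-equivariant time-periodic Type-I orbit of the
backward Leray system.** There are a finite subgroup `G` of the linear isometries of `ℝ³`
consisting of rotations (`det = 1`) and acting irreducibly on `ℝ³` (equivalently: `G` is conjugate
to the chiral tetrahedral, octahedral or icosahedral group), a period `S > 0` and a classical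
solution `(U, P)` of the backward Leray system `∂ₛU + ½U + ½(y·∇)U + (U·∇)U + ∇P = ΔU`, `div U = 0`
on all of `ℝ × ℝ³` (`IsBackwardLeraySolutionOn univ 1 U P`: jointly smooth, pointwise equations)
which is `S`-periodic in `s`, obeys the profile Type-I bound `(1 + ‖y‖) ‖U(s, y)‖ ≤ C₀`, is
`G`-equivariant (`U(s, g y) = g U(s, y)`), and is not identically zero.
Why it might fail: the polyhedral Type-I Liouville theorem (route crux #3) or Tsai's DSS Liouville
conjecture (Tsai 2018, Conj. 8.8–8.9) may hold; steady orbits are excluded (Tsai 1998,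
Nečas–Růžička–Šverák 1996) and so is `S → 0⁺` at fixed `C₀` (Chae–Wolf 2017, Thm 1.3).
[sources: ChaeWolf2017RemovingDSS §4 and Thm 1.3; BradshawTsai2017CPDE §5 Open Problem 5.1;
Tsai2018 Conj. 8.8–8.9; Tsai1998; NecasRuzickaSverak1996] -/
theorem stub_periodicLerayOrbit :
    ∃ G : Subgroup (ℝ³ ≃ₗᵢ[ℝ] ℝ³), Finite G ∧
      (∀ g ∈ G, LinearMap.det (g.toLinearEquiv : ℝ³ →ₗ[ℝ] ℝ³) = 1) ∧
      (∀ V : Submodule ℝ ℝ³, (∀ g ∈ G, ∀ v ∈ V, g v ∈ V) → V = ⊥ ∨ V = ⊤) ∧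
      ∃ S : ℝ, 0 < S ∧ ∃ (U : ℝ → ℝ³ → ℝ³) (P : ℝ → ℝ³ → ℝ),
        IsBackwardLeraySolutionOn univ 1 U P ∧ Function.Periodic U S ∧
        (∃ C₀ : ℝ, ∀ s y, (1 + ‖y‖) * ‖U s y‖ ≤ C₀) ∧
        (∀ g ∈ G, ∀ s y, U s (g y) = g (U s y)) ∧ (∃ s y, U s y ≠ 0) := by
  sorry

/-- **Stub 2 (the KNSS mild gauge is automatic under Type-I decay).** A classical solution
`(u, p)` of Navier–Stokes (`ν = 1`, zero force) on the open past `(−∞, 0) × ℝ³` whose velocity obeys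
the Type-I space–time bound `‖u(t, x)‖ ≤ C₀ / (‖x‖ + √(−t))` is an ancient mild solution in the
duality sense of the tree (`IsAncientMildSolution 1 u`: weakly divergence-free slices and the
two-time duality identity between all `s < t < 0`). Proof route: on each slab `[s, t] ⊂ (−∞, 0)` the
velocity is bounded by `C₀/√(−t)`; write `p = p̃ + q` with `p̃ = RᵢRⱼ(uᵢuⱼ)` and `q(τ, ·)` harmonic;
testing the equation against translates of a bump and integrating in time shows `∫ₛᵗ ∇q dτ` is a
bounded harmonic field, hence constant in `x` (Liouville), and the Type-I decay of `u` at spatial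
infinity forces the constant to vanish, so `∇p = ∇p̃`; then the Fabes–Jones–Rivière cut-off pairing of
`IsClassicalNSSolutionOn.isMildNSSolutionOn_holds` applies with the pressure `p̃ ∈ L^q`, `q > 3/2`.
Why it might fail (as a Lean task): the Liouville step needs the distributional equation tested
against non-compactly supported (Gaussian) fields and `L^q` bounds on `RᵢRⱼ(u ⊗ u)`; size M/L.
[sources: KNSS2009 §1 (parasitic solutions, mild ancient solutions); SereginSverak2009 (1.1);
FabesJonesRiviere1972 Thm 2.1 (i); tree `IsClassicalNSSolutionOn.isMildNSSolutionOn_holds`,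
`IsTypeIAncientMild`]
LANDED (lead c14, wave 1, p148604): `Theorems/QuantisedSymmetryPolyhedralDssProfileExistsStubAncientMildOfClassicalTypeI.lean`,
via the discharged KNSS 2009 Thm 6.1 mildness clause `KNSS2009_mild_of_rMulNorm_bounded_holds`. -/
theorem stub_ancientMild_of_classical_typeI :
    ∀ (u : ℝ → ℝ³ → ℝ³) (p : ℝ → ℝ³ → ℝ) (C₀ : ℝ),
      IsClassicalNSSolutionOn (Iio 0) 1 0 u p → HasTypeIDecay C₀ u → IsAncientMildSolution 1 u :=
  _root_.Summit.NavierStokesRegularity.NavierStokesRegularity.Theorems.PolyhedralDssProfileExists.Birth.stub_ancientMild_of_classical_typeI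

/-! ## Composition (kernel-checked; no `sorry` in the closure of `PolyhedralDssProfileExists_of`) -/

/-- **Composition: the remaining stub implies the crux `QuantisedSymmetry.PolyhedralDssProfileExists` BY NAME.**
Hypothesis keyed by the registered stub name (`Registered.stub_periodicLerayOrbit`, `rfl`-equal to the
literal stub signature); stub 2 is discharged by the landed theorem
`Theorems.PolyhedralDssProfileExists.Birth.stub_ancientMild_of_classical_typeI` (p148604); the witness is
the physical field `u = ofLerayOrbit U` of the periodic orbit of stub 1 with DSS factor `λ = e^{S/2}`. -/
theorem PolyhedralDssProfileExists_of (h₁ : Registered.stub_periodicLerayOrbit) :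
    _root_.Summit.NavierStokesRegularity.NavierStokesRegularity.Theses.QuantisedSymmetry.PolyhedralDssProfileExists := by
  dsimp only [Registered.stub_periodicLerayOrbit, PeriodicLerayOrbitExists] at h₁
  obtain ⟨G, hfin, hdet, hirr, S, hS, U, P, hsol, hper, ⟨C₀, hC₀⟩, heqv, s₀, y₀, hne⟩ := h₁
  have hmild : AncientMildOfClassicalTypeI :=
    _root_.Summit.NavierStokesRegularity.NavierStokesRegularity.Theorems.PolyhedralDssProfileExists.Birth.stub_ancientMild_of_classical_typeI
  -- the physical velocity `u = ofLerayOrbit U` and pressure `ofLerayOrbitPressure P`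
  have hcl : IsClassicalNSSolutionOn (Iio 0) 1 0 (ofLerayOrbit U) (ofLerayOrbitPressure P) :=
    isClassicalNSSolutionOn_Iio_ofLerayOrbit_iff.2 hsol
  have hU : lerayOrbit (ofLerayOrbit U) = U := lerayOrbit_ofLerayOrbit_eq U
  have hdecay : HasTypeIDecay C₀ (ofLerayOrbit U) :=
    hasTypeIDecay_iff_lerayOrbit.2 (by rw [hU]; exact hC₀)
  have hanc : IsAncientMildSolution 1 (ofLerayOrbit U) :=
    hmild (ofLerayOrbit U) (ofLerayOrbitPressure P) C₀ hcl hdecay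
  -- the DSS factor `λ = e^{S/2}`, `2 log λ = S`
  have hc_pos : 0 < Real.exp (S / 2) := Real.exp_pos _
  have hc1 : 1 < Real.exp (S / 2) := Real.one_lt_exp_iff.2 (by linarith)
  have hlogc : 2 * Real.log (Real.exp (S / 2)) = S := by rw [Real.log_exp]; ring
  have hdss : IsDiscretelySelfSimilar (Real.exp (S / 2)) (ofLerayOrbit U) := by
    have hper' : Function.Periodic (lerayOrbit (ofLerayOrbit U)) (2 * Real.log (Real.exp (S / 2))) := by
      rw [hU, hlogc]; exact hper
    have hpast := (periodic_lerayOrbit_iff hc_pos).1 hper'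
    funext t x
    by_cases ht : t < 0
    · exact congrFun (hpast t ht) x
    · -- junk region `t ≥ 0`: both sides vanish (`√(−t) = 0`, `0⁻¹ = 0`)
      have ht' : 0 ≤ t := not_lt.1 ht
      have hct : 0 ≤ Real.exp (S / 2) ^ 2 * t := mul_nonneg (sq_nonneg _) ht'
      have h1 : Real.sqrt (-(Real.exp (S / 2) ^ 2 * t)) = 0 := Real.sqrt_eq_zero'.2 (by linarith)
      have h2 : Real.sqrt (-t) = 0 := Real.sqrt_eq_zero'.2 (by linarith)
      rw [nsRescale_apply, ofLerayOrbit_apply, ofLerayOrbit_apply, h1, h2]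
      simp
  -- continuity of the slices on the past
  have hcont : ∀ t < 0, Continuous (ofLerayOrbit U t) := fun t ht =>
    (hcl.contDiff_velocity (S := Iio 0) ht).continuous
  refine ⟨G, hfin, hdet, hirr, Real.exp (S / 2), hc1, ofLerayOrbit U, hanc,
    fun t ht => (hcont t ht).aestronglyMeasurable, hdss, ⟨C₀, hdecay⟩, ?_, ?_⟩
  · -- `G`-equivariance transfers along the linear isometries
    intro g hg t x
    rw [ofLerayOrbit_apply, ofLerayOrbit_apply, ← map_smul g, heqv g hg, map_smul g]
  · -- nontriviality: a continuous slice that vanishes a.e. vanishes, and `lerayOrbit ∘ ofLerayOrbit = id`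
    intro hzero
    have ht₀ : -Real.exp (-s₀) < 0 := neg_exp_neg_lt_zero s₀
    have hz : ofLerayOrbit U (-Real.exp (-s₀)) = 0 :=
      Measure.eq_of_ae_eq (hzero _ ht₀) (hcont _ ht₀) continuous_const
    apply hne
    have key := congrFun (congrFun hU s₀) y₀
    rw [lerayOrbit_apply, hz] at key
    simpa using key.symm


/-! ## Necessary conditions on witnesses of `stub_periodicLerayOrbit` (lead c14; proved, no sorry)

PARKED LINE (2026-08-17T09:25Z): the live skeleton is `Lines/polyhedral_cell.lean`; this file keeps the
birth composition (1 stub) and records, with proofs in the stub's own variables, what every witness of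
`stub_periodicLerayOrbit` must satisfy: Schur (`U(s, 0) = 0` for irreducible `G`), the Chae–Wolf
period lower bound (`S ≥ S₀(C₀)`), and the exclusion of steady profiles (Tsai 1998 / NRŠ 1996, here
from Chae–Wolf Thm 1.3). These cannot land `--supports` (the lane requires a registered stub), so they
live here. -/

/-- **A vector fixed by an irreducible group of isometries of `ℝ³` vanishes** (Schur): if every
`G`-invariant subspace of `ℝ³` is `⊥` or `⊤` and `g v = v` for all `g ∈ G`, then `v = 0` — the line
`ℝ v` is invariant and cannot be all of `ℝ³`. -/
theorem fixedVector_eq_zero {G : Subgroup (EuclideanSpace ℝ (Fin 3) ≃ₗᵢ[ℝ] EuclideanSpace ℝ (Fin 3))}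
    (hirr : ∀ V : Submodule ℝ (EuclideanSpace ℝ (Fin 3)), (∀ g ∈ G, ∀ v ∈ V, g v ∈ V) → V = ⊥ ∨ V = ⊤)
    {v : EuclideanSpace ℝ (Fin 3)} (hv : ∀ g ∈ G, g v = v) : v = 0 := by
  have hinv : ∀ g ∈ G, ∀ w ∈ (ℝ ∙ v), g w ∈ (ℝ ∙ v) := by
    intro g hg w hw
    obtain ⟨a, rfl⟩ := Submodule.mem_span_singleton.1 hw
    rw [map_smul, hv g hg]
    exact Submodule.smul_mem _ a (Submodule.mem_span_singleton_self v)
  rcases hirr (ℝ ∙ v) hinv with h | h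
  · have hmem : v ∈ (ℝ ∙ v) := Submodule.mem_span_singleton_self v
    rw [h] at hmem
    simpa using hmem
  · exfalso
    have h1 : Module.finrank ℝ (ℝ ∙ v) ≤ 1 := by
      simpa using finrank_span_le_card ({v} : Set (EuclideanSpace ℝ (Fin 3)))
    rw [h, finrank_top, finrank_euclideanSpace_fin] at h1
    omega

/-- **Equivariant fields vanish at the origin**: if `G` acts irreducibly on `ℝ³` and
`U(s, g y) = g U(s, y)` for all `g ∈ G`, then `U(s, 0) = 0` for every `s` (the value at the fixed
point `0` is a `G`-fixed vector). For a witness of `stub_periodicLerayOrbit` / X⁻ this is the first of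
the Schur constraints `U(0) = 0`, `∇U(0) = 0` of the route thesis. -/
theorem apply_zero_eq_zero_of_equivariant {G : Subgroup (EuclideanSpace ℝ (Fin 3) ≃ₗᵢ[ℝ] EuclideanSpace ℝ (Fin 3))}
    (hirr : ∀ V : Submodule ℝ (EuclideanSpace ℝ (Fin 3)), (∀ g ∈ G, ∀ v ∈ V, g v ∈ V) → V = ⊥ ∨ V = ⊤)
    {U : ℝ → EuclideanSpace ℝ (Fin 3) → EuclideanSpace ℝ (Fin 3)} (heqv : ∀ g ∈ G, ∀ s y, U s (g y) = g (U s y)) (s : ℝ) : U s 0 = 0 :=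
  fixedVector_eq_zero hirr fun g hg => by rw [← heqv g hg s 0, map_zero]


/-- **The physical field of a periodic orbit is discretely self-similar**: if `U` is `S`-periodic in
the similarity time then `ofLerayOrbit U` is `λ`-DSS with `λ = e^{S/2}` (on the past by
`periodic_lerayOrbit_iff`; on the junk region `t ≥ 0` both sides vanish). -/
theorem isDiscretelySelfSimilar_ofLerayOrbit_of_periodic
    {U : ℝ → EuclideanSpace ℝ (Fin 3) → EuclideanSpace ℝ (Fin 3)} {S : ℝ}
    (hper : Function.Periodic U S) :
    IsDiscretelySelfSimilar (Real.exp (S / 2)) (ofLerayOrbit U) := by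
  have hc_pos : 0 < Real.exp (S / 2) := Real.exp_pos _
  have hlogc : 2 * Real.log (Real.exp (S / 2)) = S := by rw [Real.log_exp]; ring
  have hU : lerayOrbit (ofLerayOrbit U) = U := lerayOrbit_ofLerayOrbit_eq U
  have hper' : Function.Periodic (lerayOrbit (ofLerayOrbit U)) (2 * Real.log (Real.exp (S / 2))) := by
    rw [hU, hlogc]; exact hper
  have hpast := (periodic_lerayOrbit_iff hc_pos).1 hper'
  funext t x
  by_cases ht : t < 0
  · exact congrFun (hpast t ht) x
  · have ht' : 0 ≤ t := not_lt.1 ht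
    have hct : 0 ≤ Real.exp (S / 2) ^ 2 * t := mul_nonneg (sq_nonneg _) ht'
    have h1 : Real.sqrt (-(Real.exp (S / 2) ^ 2 * t)) = 0 := Real.sqrt_eq_zero'.2 (by linarith)
    have h2 : Real.sqrt (-t) = 0 := Real.sqrt_eq_zero'.2 (by linarith)
    rw [nsRescale_apply, ofLerayOrbit_apply, ofLerayOrbit_apply, h1, h2]
    simp

/-- **Short periods are excluded (Chae–Wolf 2017, Thm 1.3, in similarity variables).** For every
`C₀ > 0` there is `S₀ > 0` such that every classical solution `(U, P)` of the backward Leray system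
`∂ₛU + ½U + ½(y·∇)U + (U·∇)U + ∇P = ΔU`, `div U = 0` on `ℝ × ℝ³` with the profile Type-I bound
`(1 + ‖y‖) ‖U(s, y)‖ ≤ C₀` which is `S`-periodic in `s` for some `0 < S < S₀` is identically zero.
Consequently every witness of `stub_periodicLerayOrbit` with constant `C₀` has all its periods
`≥ S₀(C₀)`, i.e. DSS factors `λ = e^{S/2} ≥ λ₁(C₀) > 1`. Proof: the physical field
`u = ofLerayOrbit U` is classical on the past (`isClassicalNSSolutionOn_Iio_ofLerayOrbit_iff`),
Type I (`hasTypeIDecay_iff_lerayOrbit`) and `e^{S/2}`-DSS; `chaeWolf2017_removing_dss_holds` makes it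
vanish on the past when `e^{S/2} < λ₁(C₀)`, and `U = lerayOrbit u`. -/
theorem periodicLerayOrbit_eq_zero_of_period_lt {C₀ : ℝ} (hC₀ : 0 < C₀) :
    ∃ S₀ : ℝ, 0 < S₀ ∧ ∀ S : ℝ, 0 < S → S < S₀ →
      ∀ (U : ℝ → EuclideanSpace ℝ (Fin 3) → EuclideanSpace ℝ (Fin 3))
        (P : ℝ → EuclideanSpace ℝ (Fin 3) → ℝ),
        IsBackwardLeraySolutionOn univ 1 U P → Function.Periodic U S →
        (∀ s y, (1 + ‖y‖) * ‖U s y‖ ≤ C₀) → ∀ s y, U s y = 0 := by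
  obtain ⟨c₁, hc₁, hcw⟩ := chaeWolf2017_removing_dss_holds C₀ hC₀
  refine ⟨2 * Real.log c₁, mul_pos two_pos (Real.log_pos hc₁), ?_⟩
  intro S hS hSS₀ U P hsol hper hbound s y
  -- the DSS factor `λ = e^{S/2} ∈ (1, c₁)`
  have hc1 : 1 < Real.exp (S / 2) := Real.one_lt_exp_iff.2 (by linarith)
  have hcc₁ : Real.exp (S / 2) < c₁ := by
    calc Real.exp (S / 2) < Real.exp (Real.log c₁) := Real.exp_lt_exp.2 (by linarith)
      _ = c₁ := Real.exp_log (by linarith)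
  -- the physical field
  have hcl : IsClassicalNSSolutionOn (Iio 0) 1 0 (ofLerayOrbit U) (ofLerayOrbitPressure P) :=
    isClassicalNSSolutionOn_Iio_ofLerayOrbit_iff.2 hsol
  have hU : lerayOrbit (ofLerayOrbit U) = U := lerayOrbit_ofLerayOrbit_eq U
  have hdecay : HasTypeIDecay C₀ (ofLerayOrbit U) :=
    hasTypeIDecay_iff_lerayOrbit.2 (by rw [hU]; exact hbound)
  have hdss : IsDiscretelySelfSimilar (Real.exp (S / 2)) (ofLerayOrbit U) :=
    isDiscretelySelfSimilar_ofLerayOrbit_of_periodic hper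
  have hzero := hcw (Real.exp (S / 2)) hc1 hcc₁ (ofLerayOrbit U) (ofLerayOrbitPressure P) hcl hdss hdecay
  -- back to the profile
  have key := congrFun (congrFun hU s) y
  rw [lerayOrbit_apply, hzero _ (neg_exp_neg_lt_zero s)] at key
  simpa using key.symm

/-- **Steady profiles with the Type-I profile bound vanish** (Nečas–Růžička–Šverák 1996 / Tsai 1998
for `(1 + |y|)|U| ≤ C₀`, obtained here from Chae–Wolf 2017, Thm 1.3): an `s`-independent classical
solution of the backward Leray system on `ℝ × ℝ³` — a Leray profile
`−ΔU + ½U + ½(y·∇)U + (U·∇)U + ∇P = 0`, `div U = 0` — with `(1 + ‖y‖)‖U(y)‖ ≤ C₀` is zero: it is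
`S`-periodic for every `S > 0`, in particular for `S < S₀(C₀)`. So witnesses of
`stub_periodicLerayOrbit` are genuinely time-dependent. -/
theorem steadyLerayProfile_eq_zero_of_typeI {C₀ : ℝ}
    {U : EuclideanSpace ℝ (Fin 3) → EuclideanSpace ℝ (Fin 3)} {P : EuclideanSpace ℝ (Fin 3) → ℝ}
    (hsol : IsBackwardLeraySolutionOn univ 1 (fun _ : ℝ => U) (fun _ : ℝ => P))
    (hbound : ∀ y, (1 + ‖y‖) * ‖U y‖ ≤ C₀) : U = 0 := by
  funext y
  rcases le_or_gt C₀ 0 with hC₀ | hC₀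
  · -- degenerate constant: the bound forces `U = 0` directly
    have h1 : (1 + ‖y‖) * ‖U y‖ ≤ 0 := (hbound y).trans hC₀
    have h2 : 0 < 1 + ‖y‖ := by positivity
    have h3 : ‖U y‖ ≤ 0 := by
      by_contra hcon
      push Not at hcon
      have := mul_pos h2 hcon
      linarith
    simpa using le_antisymm h3 (norm_nonneg _)
  · obtain ⟨S₀, hS₀, h⟩ := periodicLerayOrbit_eq_zero_of_period_lt hC₀
    exact h (S₀ / 2) (half_pos hS₀) (half_lt_self hS₀) (fun _ => U) (fun _ => P) hsol
      (fun _ => rfl) (fun _ y => hbound y) 0 y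


/-! ## Wiring check -/

/-- A local copy of the crux (so that exactly ONE theorem of this file concludes the crux constant itself). -/
def PolyhedralDssProfileExists' : Prop :=
  _root_.Summit.NavierStokesRegularity.NavierStokesRegularity.Theses.QuantisedSymmetry.PolyhedralDssProfileExists

/-- The sorried stub, with its LITERAL signature, feeds `PolyhedralDssProfileExists_of` exactly as
stated (this declaration inherits the one remaining `sorry` through it; `PolyhedralDssProfileExists_of`
itself is closed: axioms `propext, Classical.choice, Quot.sound`). -/
theorem polyhedralDssProfileExists_of_stubs : PolyhedralDssProfileExists' :=
  PolyhedralDssProfileExists_of stub_periodicLerayOrbit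

end Summit.NavierStokesRegularity.NavierStokesRegularity.Cruxes.PolyhedralDssProfileExists.Birth
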